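import Mathlib.Algebra.BigOperators.Ring.Finset
import Mathlib.RingTheory.Ideal.Maps
import Mathlib.RingTheory.Ideal.Quotient.Basic
import Mathlib.Data.Finset.SDiff
import HarnessLib

/-!
# Euler-factor families generated from one primitive datum: the hypotheses (P) and (L′) of the
# derivative comparison hold identically (pure commutative algebra)
# (cell `b2b-bsdres`, team n1011, ROUTE-1 PORT anatomy (P-KIM); R1-71/R1-72: PK-4b
# `KatoZetaValueDerivativeCongruence`, layer PK-4b-C2; seat p15 GEN 9)

HONEST FRAMING (cell `b2b-bsdres`, run/shared/lean/b2b/bsd-rank1-residual/, verbatim in every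
file): the goal of the cell is to DELETE the COMBINATION-SHAPED residual classes of the
Birch–Swinnerton-Dyer formula for ALL analytic-rank `≤ 1` elliptic curves over `ℚ` — "full BSD
formula for every rank `≤ 1` curve in class `C`" assembled STRICTLY from published theorems — so
that the rank-`≤ 1` remainder becomes exactly the CONSTRUCTION-SHAPED classes, which are TYPED
(missing-input `Prop`s), NOT attempted. This is not "finishing BSD". Team n1011 (N10/N11; ROUTE 1,
the PORT anatomy (P-KIM) of class X4 ∧ `p = 3`): research route on CONSTRUCTION-SHAPED classes;
prove what is provable now; no claim beyond stated classes; census output = EVIDENCE, never a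
Literature fact; RESIDUAL-MAP marks UNCHANGED; nothing is booked by this file. TOOL THEOREMS ONLY:
no definition, no named fact, no instance, no `sorry`.

## What

`EulerFactorComparisonDerivative` (PK-4b-A) compares the Kolyvagin derivatives of two families
`X Y : Finset ι → S` under (P) "same totally primitive parts", `(∏_{i∈d} (ν_i − N_i))(X d − Y d) = 0`,
and (L′) "level lowering through the norms", `N_U X d = PX U d · X (d∖U)`. This file shows that both
hold ON THE NOSE for the families GENERATED from one top-level datum `B ∈ S` (in the application: the
element of `ℂ[(ℤ/n)ˣ]` whose character components are the PRIMITIVE values — Birch sums at the conductor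
times the common factors `E_A · C`): given "projectors" `e_i` with `N_i e_i = N_i` and `(ν_i − N_i) e_i = 0`
(in the application `e_i = ν_i⁻¹ N_i`, `proj_of_norm`), local factors `P_i` and the top level `r`, a
family `F` with
`F d = (∏_{j ∈ r∖d} N_j) · (∏_{i∈d} (e_i P_i + (1 − e_i))) · B`   for `d ⊆ r`   (hypothesis `hF`; no definition)
— level `d` embedded in the top-level ring as a NORM multiple — satisfies
(L′) `N_U F d = (∏_{i∈U} P_i) · F (d∖U)` for `U ⊆ d ⊆ r` (`prod_norm_mul_family_eq`), and two such
families with the same `e`, `B`, `r` and factors `P`, `P′` have the same totally primitive parts at every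
level (`prod_sub_norm_mul_family_sub_eq_zero`). The Euler-factor difference `∏_U P_i − ∏_U P′_i` lies in
any ideal containing one `P_i − P′_i`… precisely: in `J` as soon as all `P_i − P′_i ∈ J`
(`prod_sub_prod_mem_of_sub_mem`), and is a MULTIPLE of `P_i − P′_i` for `U = {i}`; in the application
`P_i − P′_i = (1 − ℓ_i)σ` with `ℓ_i ≡ 1 (mod 3^{k+1})` (r1 GEN 45: the `n`-normalised Kato factor
`a_ℓ − σ_ℓ⁻¹ − ℓσ_ℓ` against the Mazur–Tate factor `a_ℓ − σ_ℓ⁻¹ − σ_ℓ`). So the Kato instantiation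
(PK-4b-C) only has to identify the two TOP-LEVEL elements, and the modular pull-backs, with generated
families by their character components (PK-4a on the Kato side, F-C on the modular side).
HONEST LIMITS: pure algebra; no group ring, character, Kato object or congruence here; closes nothing.

References: K. Rubin, *Euler Systems* (2000) §9.6 "Varying the Euler factors"; r1 ROUTE-1 §55–57
R1-71/R1-72 (cells/n1011/ROUTE-1.md).
-/

namespace Summit.BirchSwinnertonDyer.Rank1Residual.GaloisImage

namespace EulerFactorComparison

open Finset
open scoped BigOperators

variable {S : Type*} [CommRing S] {ι : Type*} [DecidableEq ι]
variable (N e ν P P' : ι → S) (B : S) (r : Finset ι) (F F' : Finset ι → S)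

/-! ### §1 Norms and primitive projectors against the local factors -/

omit [DecidableEq ι] in
/-- `N_i (e_i P_i + (1 − e_i)) = N_i P_i` when `N_i e_i = N_i`. [folklore] -/
theorem norm_mul_localFactor {i : ι} (he : N i * e i = N i) :
    N i * (e i * P i + (1 - e i)) = N i * P i := by
  rw [mul_add, ← mul_assoc, he, mul_sub, mul_one, he, sub_self, add_zero]

omit [DecidableEq ι] in
/-- `(ν_i − N_i)(e_i P_i + (1 − e_i)) = ν_i − N_i` when `(ν_i − N_i) e_i = 0`: the totally primitive
projector does not see the local factor. [folklore] -/
theorem sub_norm_mul_localFactor {i : ι} (hνe : (ν i - N i) * e i = 0) :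
    (ν i - N i) * (e i * P i + (1 - e i)) = ν i - N i := by
  rw [mul_add, ← mul_assoc, hνe, zero_mul, zero_add, mul_sub, mul_one, hνe, sub_zero]

omit [DecidableEq ι] in
/-- Over a set `U`: `N_U ∏_{i∈U} (e_i P_i + (1 − e_i)) = N_U ∏_{i∈U} P_i`. [folklore] -/
theorem prod_norm_mul_prod_localFactor (he : ∀ i, N i * e i = N i) (U : Finset ι) :
    (∏ i ∈ U, N i) * ∏ i ∈ U, (e i * P i + (1 - e i)) = (∏ i ∈ U, N i) * ∏ i ∈ U, P i := by
  rw [← Finset.prod_mul_distrib, ← Finset.prod_mul_distrib]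
  exact Finset.prod_congr rfl fun i _ => norm_mul_localFactor N e P (he i)

omit [DecidableEq ι] in
/-- Over a set `d`: `(∏_{i∈d} (ν_i − N_i)) ∏_{i∈d} (e_i P_i + (1 − e_i)) = ∏_{i∈d} (ν_i − N_i)`. [folklore] -/
theorem prod_sub_norm_mul_prod_localFactor (hνe : ∀ i, (ν i - N i) * e i = 0) (d : Finset ι) :
    (∏ i ∈ d, (ν i - N i)) * ∏ i ∈ d, (e i * P i + (1 - e i)) = ∏ i ∈ d, (ν i - N i) := by
  rw [← Finset.prod_mul_distrib]
  exact Finset.prod_congr rfl fun i _ => sub_norm_mul_localFactor N e ν P (hνe i)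

/-! ### §2 (L′): level lowering through the norms holds identically -/

/-- For `U ⊆ d ⊆ r`: `r ∖ (d ∖ U) = (r ∖ d) ∪ U`, disjointly. [folklore] -/
theorem sdiff_sdiff_eq_sdiff_union {U d : Finset ι} (hUd : U ⊆ d) (hdr : d ⊆ r) :
    r \ (d \ U) = (r \ d) ∪ U := by
  ext x
  simp only [Finset.mem_sdiff, Finset.mem_union]
  constructor
  · rintro ⟨hxr, hx⟩
    by_cases hxU : x ∈ U
    · exact Or.inr hxU
    · exact Or.inl ⟨hxr, fun hxd => hx ⟨hxd, hxU⟩⟩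
  · rintro (⟨hxr, hxd⟩ | hxU)
    · exact ⟨hxr, fun h => hxd h.1⟩
    · exact ⟨hdr (hUd hxU), fun h => h.2 hxU⟩

/-- **(L′) for a generated family**: if `F d = (∏_{j∈r∖d} N_j)(∏_{i∈d} (e_i P_i + (1 − e_i))) B` for all
`d ⊆ r`, then `N_U F d = (∏_{i∈U} P_i) F (d ∖ U)` for `U ⊆ d ⊆ r`. [folklore] -/
theorem prod_norm_mul_family_eq (he : ∀ i, N i * e i = N i)
    (hF : ∀ d, d ⊆ r → F d = (∏ j ∈ r \ d, N j) * (∏ i ∈ d, (e i * P i + (1 - e i))) * B)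
    {d U : Finset ι} (hUd : U ⊆ d) (hdr : d ⊆ r) :
    (∏ i ∈ U, N i) * F d = (∏ i ∈ U, P i) * F (d \ U) := by
  have hdisj : Disjoint (r \ d) U := (Finset.disjoint_sdiff (s := d) (t := r)).symm.mono_right hUd
  rw [hF d hdr, hF (d \ U) (Finset.sdiff_subset.trans hdr), ← Finset.prod_sdiff hUd,
    sdiff_sdiff_eq_sdiff_union r hUd hdr, Finset.prod_union hdisj]
  calc (∏ i ∈ U, N i) * ((∏ j ∈ r \ d, N j) *
        ((∏ i ∈ d \ U, (e i * P i + (1 - e i))) * ∏ i ∈ U, (e i * P i + (1 - e i))) * B)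
      = ((∏ i ∈ U, N i) * ∏ i ∈ U, (e i * P i + (1 - e i))) *
          ((∏ j ∈ r \ d, N j) * (∏ i ∈ d \ U, (e i * P i + (1 - e i))) * B) := by ring
    _ = ((∏ i ∈ U, N i) * ∏ i ∈ U, P i) *
          ((∏ j ∈ r \ d, N j) * (∏ i ∈ d \ U, (e i * P i + (1 - e i))) * B) := by
        rw [prod_norm_mul_prod_localFactor N e P he U]
    _ = (∏ i ∈ U, P i) * (((∏ j ∈ r \ d, N j) * ∏ i ∈ U, N i) *
          (∏ i ∈ d \ U, (e i * P i + (1 - e i))) * B) := by ring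

/-! ### §3 (P): two generated families have the same totally primitive parts -/

omit [DecidableEq ι] in
/-- **(P) for two generated families** with the same projectors, top level and primitive datum:
`(∏_{i∈d} (ν_i − N_i)) (F d − F′ d) = 0` (at every `d` where both have the generated shape, with any
common prefactor `M`). [folklore] -/
theorem prod_sub_norm_mul_family_sub_eq_zero (hνe : ∀ i, (ν i - N i) * e i = 0) {d : Finset ι} {M : S}
    (hF : F d = M * (∏ i ∈ d, (e i * P i + (1 - e i))) * B)
    (hF' : F' d = M * (∏ i ∈ d, (e i * P' i + (1 - e i))) * B) :
    (∏ i ∈ d, (ν i - N i)) * (F d - F' d) = 0 := by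
  rw [hF, hF']
  calc (∏ i ∈ d, (ν i - N i)) * (M * (∏ i ∈ d, (e i * P i + (1 - e i))) * B -
        M * (∏ i ∈ d, (e i * P' i + (1 - e i))) * B)
      = M * B * ((∏ i ∈ d, (ν i - N i)) * ∏ i ∈ d, (e i * P i + (1 - e i)) -
          (∏ i ∈ d, (ν i - N i)) * ∏ i ∈ d, (e i * P' i + (1 - e i))) := by ring
    _ = 0 := by
        rw [prod_sub_norm_mul_prod_localFactor N e ν P hνe, prod_sub_norm_mul_prod_localFactor N e ν P' hνe,
          sub_self, mul_zero]

/-! ### §4 The Euler-factor difference along `U`, and the projectors of the application -/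

omit [DecidableEq ι] in
/-- If `P_i − P′_i ∈ J` for all `i ∈ U` then `∏_{i∈U} P_i − ∏_{i∈U} P′_i ∈ J`. [folklore] -/
theorem prod_sub_prod_mem_of_sub_mem (J : Ideal S) {U : Finset ι} (h : ∀ i ∈ U, P i - P' i ∈ J) :
    (∏ i ∈ U, P i) - ∏ i ∈ U, P' i ∈ J := by
  rw [← Ideal.Quotient.eq, map_prod, map_prod]
  exact Finset.prod_congr rfl fun i hi => (Ideal.Quotient.eq).mpr (h i hi)

omit [DecidableEq ι] in
/-- With one factor extracted: `∏_{i∈U} P_i − ∏_{i∈U} P′_i = (P_i − P′_i) ∏_{U∖i} P_j + P′_i (∏_{U∖i} P_j − ∏_{U∖i} P′_j)`,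
so by induction the difference is an `S`-combination of the `P_j − P′_j`, `j ∈ U`; recorded in the
form used downstream: it lies in the ideal SPANNED by them. [folklore] -/
theorem prod_sub_prod_mem_span (U : Finset ι) :
    (∏ i ∈ U, P i) - ∏ i ∈ U, P' i ∈ Ideal.span ((fun i => P i - P' i) '' (U : Set ι)) :=
  prod_sub_prod_mem_of_sub_mem P P' _ fun i hi => Ideal.subset_span ⟨i, Finset.mem_coe.mpr hi, rfl⟩

omit [DecidableEq ι] in
/-- **The projectors of the application**: with `N_i N_i = ν_i N_i` and `w_i ν_i = 1`, the elements
`e_i := w_i N_i` satisfy `N_i e_i = N_i` and `(ν_i − N_i) e_i = 0`. [folklore] -/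
theorem proj_of_norm (w : ι → S) (hNN : ∀ i, N i * N i = ν i * N i) (hw : ∀ i, w i * ν i = 1) :
    (∀ i, N i * (w i * N i) = N i) ∧ ∀ i, (ν i - N i) * (w i * N i) = 0 := by
  refine ⟨fun i => ?_, fun i => ?_⟩
  · rw [mul_left_comm, hNN i, ← mul_assoc, hw i, one_mul]
  · rw [sub_mul, mul_left_comm (N i), hNN i, mul_left_comm, sub_self]

/-- **Images in a bigger ring** (the application: `R = ℤ₍₃₎[G] → S = ℚ₃[G]`, `𝔞 = 3^{k+1}R`): a product
`φ(a) · φ(b) · (φ(w) · φ(y))` with `w ∈ 𝔞` lies in the additive image `φ(𝔞)`. [folklore] -/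
theorem mul_mul_mem_map_of_mem {R : Type*} [CommRing R] (φ : R →+* S) (𝔞 : Ideal R) (a b w y : R)
    (hw : w ∈ 𝔞) : φ a * (φ b * (φ w * φ y)) ∈ (𝔞.toAddSubmonoid.map (φ : R →+ S) : AddSubmonoid S) := by
  refine ⟨a * (b * (w * y)), ?_, by simp only [AddMonoidHom.coe_coe, map_mul]⟩
  exact 𝔞.mul_mem_left _ (𝔞.mul_mem_left _ (𝔞.mul_mem_right _ hw))

end EulerFactorComparison

end Summit.BirchSwinnertonDyer.Rank1Residual.GaloisImage
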